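import Summits.ResolutionOfSingularities.ResolutionOfSingularities.Theorems.MarkedTransferCampaignW46CuspStaircaseFibre
import HarnessLib

/-!
# [OURS · L1 W4.6, rung (iii)] The cusp staircase — one singular child per stair, `#Sing` never increases, and the exit
# bound `Σ(E₀)/b` (cell res-hironaka, LADDER-RESOLUTION rung L, D-0089; slot W4.6, seat res-L1-s46-pv-5; host route
# MarkedTransfer, `--supports stmt-ResolutionOfSingularities-16155 --as helper`)

HONEST FRAMING. Nothing here is a statement of H. Hironaka's manuscript (2017-03-23, [Hironaka2017]) and nothing here
asserts that any statement of it holds. These are THEOREMS about the OURS definitions of `…CuspStaircase.lean`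
(`Regime.cuspCurve`, `cuspIndexAt`, `cuspMultiset`) over the shared typed-procedure module (res-L1-type-o1; `Step`,
`Run`, `IsCentre.subset_sing`, `Run.sing_nonempty` of res-L1-s46-pv-4), assembled from this seat's `…CuspStaircaseFibre`
(fibre uniqueness `Cusp.eq_of_le_of_le`), `…Descent` and `…Dichotomy`. The typed candidate carriers enter only as the
DATA a step / run quantifies over. No FACT-LIST premise; no `sorry`; axioms standard. AI review is weaker than expert
review.

## What is proved (namespace `…Theorems.CampaignW46`)

* `Step.sing_over_subsingleton` — **one singular child per stair**: at a typed step from a state in `Regime.cuspCurve`,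
  at most ONE point of `Sing(E′)` lies over the centre.
* `Step.sing_finite_and_ncard_le_of_cuspCurve` — hence `Sing(E′)` is finite (the finiteness hypothesis of
  `CuspCurveDescent` holds automatically along the staircase) and **`#Sing(E′) ≤ #Sing(E)`**: the window invariant
  `#Sing` never increases on the whole family (it drops exactly on the last stair, `…Dichotomy`, and stalls on the higher
  stairs, `…MohWindowBoundary`).
* `Step.sum_cuspMultiset_add_le` — the TOTAL cusp index drops by at least `b` at every step: `Σ(E′) + b ≤ Σ(E)`
  (`Σ = Multiset.sum ∘ cuspMultiset`).
* `Run.b_eq`, `Run.exists_exit_le_sum_div_of_cuspCurve` — **exit bound** (effective form of `CuspCurveTerminates`): every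
  run of the typed procedure (any `N`, any `Rd`) has a stage `k ≤ Σ(E₀)/b` outside `Regime.cuspCurve` — for K4.6's
  `K_{p,n}` (one cusp of index `≤ n`, `…CuspStaircaseWitness`) at most `⌊n/p⌋` steps, the resolution length recorded by
  ATLAS-RUN j259568 (72/72 rows).

## References

* `Theorems/MarkedTransferCampaignW46CuspStaircase*.lean`, `…MohWindow*.lean` (this seat); L/res-L0-k46/KILL-TEST-K4.6.md
  §2–§4 (kit job j258573, ALIVE, `B(p) = 2p`; ATLAS-RUN j259568).
* H. Hironaka, ms. 2017-03-23, Th. 16.6 p.84 l.4–20, Th. 16.13 p.87 l.26–28 — scope only, under adjudication, not cited as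
  fact. [Hironaka2017]
-/

noncomputable section

set_option linter.dupNamespace false -- mandated namespace of this single-conjunct summit

open CategoryTheory CategoryTheory.Limits AlgebraicGeometry TopologicalSpace IsLocalRing

namespace Summit.ResolutionOfSingularities.ResolutionOfSingularities.Theorems

namespace CampaignW46

open Literature.AlgebraicGeometry.Resolution
open Literature.AlgebraicGeometry.Hironaka2017.S02Preliminaries
open Literature.AlgebraicGeometry.Hironaka2017.Datum
open Scheme.IdealSheafData

universe u

/-! ## Campaign level: one singular child per stair, `#Sing` never increases, exit bound -/

section Campaign

variable {n : ℕ} {p : ℕ} [Fact p.Prime] {K : Type u} [Field K] [CharP K p]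
variable {N : Notions.{u} n} {A A' : AmbientDatum p K} {E : IdealExponent A.Z} {R : Resume N A E}

/-- [OURS · L1 W4.6 rung (iii); NOT a statement of the manuscript] **One singular child per stair.** For a state in
`Regime.cuspCurve` and a typed step blowing up the closed point `ξ`, at most one point of `Sing(E′)` lies over `ξ`
(`Cusp.eq_of_le_of_le` at the least presentation of `J_ξ`). [folklore] -/
theorem Step.sing_over_subsingleton (s : Step R A') (hRg : Regime.cuspCurve A E) {ξ : A.Z}
    (hDξ : (s.D : Set A.Z) = {ξ}) : {x' ∈ s.E'.sing | s.π.base x' = ξ}.Subsingleton := by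
  classical
  intro x₁ h₁ x₂ h₂
  obtain ⟨h₁S, h₁⟩ := h₁
  obtain ⟨h₂S, h₂⟩ := h₂
  obtain ⟨hb, -, hcl, hcusp⟩ := hRg
  haveI : IsLocallyNoetherian A'.Z := by
    haveI := A'.smooth
    exact LocallyOfFiniteType.isLocallyNoetherian A'.hom
  have hξS : ξ ∈ E.sing := by
    apply s.centre.subset_sing
    rw [hDξ]
    exact Set.mem_singleton _
  have hξcl : IsClosed ({ξ} : Set A.Z) := hcl hξS
  have hY : stalkIdeal (vanishingIdeal s.D) ξ = maximalIdeal (A.Z.presheaf.stalk ξ) := by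
    apply stalkIdeal_vanishingIdeal_eq_maximalIdeal_of_closure_eq
    rw [hDξ, hξcl.closure_eq]
  obtain ⟨hnd, hreg, hdim, x, y, hxy, u, hu, hJ⟩ := Cusp.cuspIndex_spec (hcusp ξ hξS)
  haveI := hreg
  have hbd : E.b < cuspIndexAt E ξ :=
    Cusp.lt_of_cuspShape_of_le_pow ⟨hreg, hdim, x, y, hxy, u, hu, hJ⟩ hnd (stalkIdeal_le_pow_of_mem_sing hξS)
  obtain ⟨c, hc_def⟩ : ∃ c : Fin 2 → A.Z.presheaf.stalk ξ, c = ![x, y] := ⟨_, rfl⟩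
  have hc0 : c 0 = x := by rw [hc_def]; rfl
  have hc1 : c 1 = y := by rw [hc_def]; rfl
  have hc : Ideal.span (Set.range c) = maximalIdeal _ := by rw [hc_def, MohWindow.range_vec2]; exact hxy
  have hJc : stalkIdeal E.J ξ = Ideal.span {c 1 ^ E.b + u * c 0 ^ cuspIndexAt E ξ} := by
    rw [hJ, hc0, hc1]; rfl
  exact Cusp.eq_of_le_of_le s.blowup hb hbd hdim c hc hY hu hJc h₁ h₂ h₁S h₂S

/-- [OURS · L1 W4.6 rung (iii); NOT a statement of the manuscript] **`#Sing` never increases on the staircase.** For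
a state in `Regime.cuspCurve` and a step admitted by the typed centre rule, `Sing(E′)` is FINITE (no finiteness
hypothesis needed any more) and `#Sing(E′) ≤ #Sing(E)`: off the centre `π` is injective into `Sing(E) ∖ {ξ}`, over the
centre there is at most one singular point. (Inside the window it drops, `Step.sing_finite_and_ncard_lt_of_cuspIndexAt_lt`;
K4.6 / ATLAS-RUN j259568: «one singular child per step».) [folklore] -/
theorem Step.sing_finite_and_ncard_le_of_cuspCurve (s : Step R A') (hRg : Regime.cuspCurve A E) :
    s.E'.sing.Finite ∧ s.E'.sing.ncard ≤ E.sing.ncard := by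
  classical
  obtain ⟨ξ, hξS, hξcl, hDξ⟩ := s.centre.exists_eq_singleton_of_cuspCurve hRg
  have hfin : E.sing.Finite := hRg.2.1
  obtain ⟨off, hoff_def⟩ : ∃ off : Set A'.Z, off = {x' ∈ s.E'.sing | s.π.base x' ≠ ξ} := ⟨_, rfl⟩
  obtain ⟨fib, hfib_def⟩ : ∃ fib : Set A'.Z, fib = {x' ∈ s.E'.sing | s.π.base x' = ξ} := ⟨_, rfl⟩
  have hunion : s.E'.sing = off ∪ fib := by
    ext x'
    rw [hoff_def, hfib_def]
    simp only [Set.mem_union, Set.mem_setOf_eq]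
    tauto
  have hoff_maps : Set.MapsTo s.π.base off (E.sing \ {ξ}) := fun x' hx' => by
    rw [hoff_def] at hx'
    exact ⟨(s.mem_sing_and_cuspIndexAt_eq_of_ne hDξ hx'.1 hx'.2).1, hx'.2⟩
  have hoff_inj : Set.InjOn s.π.base off := by
    refine (MohWindow.injOn_preimage_compl s.blowup).mono fun x' hx' => ?_
    show s.π.base x' ∈ (s.D : Set A.Z)ᶜ
    rw [hDξ]
    rw [hoff_def] at hx'
    exact hx'.2
  have hoff_fin : off.Finite :=
    Set.Finite.of_finite_image ((hfin.subset fun _ hx => hx.1).subset hoff_maps.image_subset) hoff_inj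
  have hfib_sub : fib.Subsingleton := by rw [hfib_def]; exact s.sing_over_subsingleton hRg hDξ
  have hfib_fin : fib.Finite := hfib_sub.finite
  refine ⟨hunion ▸ hoff_fin.union hfib_fin, ?_⟩
  have h1 : off.ncard ≤ (E.sing \ {ξ}).ncard :=
    Set.ncard_le_ncard_of_injOn s.π.base hoff_maps hoff_inj (hfin.subset fun _ hx => hx.1)
  have h2 : fib.ncard ≤ 1 := (Set.ncard_le_one hfib_fin).mpr fun a ha b hb => hfib_sub ha hb
  have h3 : (E.sing \ {ξ}).ncard = E.sing.ncard - 1 := Set.ncard_sdiff_singleton_of_mem hξS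
  have h4 : 0 < E.sing.ncard := (Set.ncard_pos hfin).mpr ⟨ξ, hξS⟩
  calc s.E'.sing.ncard = (off ∪ fib).ncard := by rw [hunion]
    _ ≤ off.ncard + fib.ncard := Set.ncard_union_le _ _
    _ ≤ E.sing.ncard := by omega

/-- [OURS · L1 W4.6 rung (iii); NOT a statement of the manuscript] **The total cusp index drops by at least `b` at
every step.** For a state in `Regime.cuspCurve` and a step admitted by the typed centre rule, the sums of the cusp
indices satisfy `Σ(E′) + b ≤ Σ(E)` (`Multiset.sum` of `cuspMultiset`): off the centre indices are unchanged and `π` is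
injective, over the centre there is at most one singular point and its index is `≤ index(ξ) − b` (or there is none,
and `index(ξ) > b` is removed). [folklore] -/
theorem Step.sum_cuspMultiset_add_le (s : Step R A') (hRg : Regime.cuspCurve A E) :
    (cuspMultiset s.E').sum + E.b ≤ (cuspMultiset E).sum := by
  classical
  obtain ⟨ξ, hξS, hξcl, hDξ⟩ := s.centre.exists_eq_singleton_of_cuspCurve hRg
  have hfin : E.sing.Finite := hRg.2.1
  have hfin' : s.E'.sing.Finite := (s.sing_finite_and_ncard_le_of_cuspCurve hRg).1
  obtain ⟨S, hS⟩ : ∃ S : Finset A.Z, S = hfin.toFinset := ⟨_, rfl⟩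
  obtain ⟨S', hS'⟩ : ∃ S' : Finset A'.Z, S' = hfin'.toFinset := ⟨_, rfl⟩
  have hmemS : ∀ z, z ∈ S ↔ z ∈ E.sing := fun z => by rw [hS, Set.Finite.mem_toFinset]
  have hmemS' : ∀ z, z ∈ S' ↔ z ∈ s.E'.sing := fun z => by rw [hS', Set.Finite.mem_toFinset]
  set Soff := S'.filter (fun x' => s.π.base x' ≠ ξ) with hSoff
  set Sfib := S'.filter (fun x' => ¬ s.π.base x' ≠ ξ) with hSfib
  set T := Soff.image s.π.base with hT
  have hoff : ∀ x' ∈ Soff, s.π.base x' ∈ E.sing ∧ cuspIndexAt s.E' x' = cuspIndexAt E (s.π.base x') :=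
    fun x' hx' => s.mem_sing_and_cuspIndexAt_eq_of_ne hDξ ((hmemS' x').mp (Finset.mem_filter.mp hx').1)
      (Finset.mem_filter.mp hx').2
  have hinj : ∀ x₁ ∈ Soff, ∀ x₂ ∈ Soff, s.π.base x₁ = s.π.base x₂ → x₁ = x₂ := by
    intro x₁ hx₁ x₂ hx₂ h
    refine MohWindow.injOn_preimage_compl s.blowup ?_ ?_ h
    · show s.π.base x₁ ∈ (s.D : Set A.Z)ᶜ
      rw [hDξ]; exact (Finset.mem_filter.mp hx₁).2
    · show s.π.base x₂ ∈ (s.D : Set A.Z)ᶜ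
      rw [hDξ]; exact (Finset.mem_filter.mp hx₂).2
  have hTS : T ⊆ S.erase ξ := by
    intro z hz
    obtain ⟨x', hx', rfl⟩ := Finset.mem_image.mp hz
    exact Finset.mem_erase.mpr ⟨(Finset.mem_filter.mp hx').2, (hmemS _).mpr (hoff x' hx').1⟩
  have hξmem : ξ ∈ S := (hmemS ξ).mpr hξS
  -- index(ξ) > b
  obtain ⟨hnd, hshape⟩ := Cusp.cuspIndex_spec (hRg.2.2.2 ξ hξS)
  have hbd : E.b < cuspIndexAt E ξ := Cusp.lt_of_cuspShape_of_le_pow hshape hnd (stalkIdeal_le_pow_of_mem_sing hξS)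
  -- the three sums
  have hM' : (cuspMultiset s.E').sum =
      ∑ x' ∈ Soff, cuspIndexAt s.E' x' + ∑ x' ∈ Sfib, cuspIndexAt s.E' x' := by
    rw [cuspMultiset_eq _ hfin', ← hS', ← Finset.sum_eq_multiset_sum, hSoff, hSfib,
      Finset.sum_filter_add_sum_filter_not]
  have hM : (cuspMultiset E).sum = ∑ z ∈ S.erase ξ, cuspIndexAt E z + cuspIndexAt E ξ := by
    rw [cuspMultiset_eq _ hfin, ← hS, ← Finset.sum_eq_multiset_sum, Finset.sum_erase_add S _ hξmem]
  have hX : ∑ x' ∈ Soff, cuspIndexAt s.E' x' = ∑ z ∈ T, cuspIndexAt E z := by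
    rw [hT, Finset.sum_image hinj]
    exact Finset.sum_congr rfl fun x' hx' => (hoff x' hx').2
  have hXle : ∑ z ∈ T, cuspIndexAt E z ≤ ∑ z ∈ S.erase ξ, cuspIndexAt E z :=
    Finset.sum_le_sum_of_subset hTS
  have hfib : ∑ x' ∈ Sfib, cuspIndexAt s.E' x' + E.b ≤ cuspIndexAt E ξ := by
    rcases Sfib.eq_empty_or_nonempty with h0 | ⟨x₀, hx₀⟩
    · rw [h0, Finset.sum_empty, zero_add]
      exact hbd.le
    · have hsub : ∀ x' ∈ Sfib, x' = x₀ := fun x' hx' => by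
        have hx'm := Finset.mem_filter.mp hx'
        have hx₀m := Finset.mem_filter.mp hx₀
        exact s.sing_over_subsingleton hRg hDξ ⟨(hmemS' _).mp hx'm.1, not_not.mp hx'm.2⟩
          ⟨(hmemS' _).mp hx₀m.1, not_not.mp hx₀m.2⟩
      have hSfib1 : Sfib = {x₀} := Finset.eq_singleton_iff_unique_mem.mpr ⟨hx₀, hsub⟩
      rw [hSfib1, Finset.sum_singleton]
      have hx₀m := Finset.mem_filter.mp hx₀
      exact (s.cuspAt_and_cuspIndexAt_le_of_over hRg hDξ ((hmemS' _).mp hx₀m.1) (not_not.mp hx₀m.2)).2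
  rw [hM', hM, hX]
  omega

/-- The exponent `b` is constant along a run. [folklore] -/
theorem Run.b_eq {Rd : Reading p K N} (r : Run N Rd) (k : ℕ) : (r.E k).b = (r.E 0).b := by
  induction k with
  | zero => rfl
  | succ k ih =>
    have h : (r.E (k + 1)).b = (r.step k).E'.b := congrArg IdealExponent.b (r.E_succ k)
    rw [h, ← ih]
    rfl

/-- [OURS · L1 W4.6 rung (iii); NOT a statement of the manuscript] **Exit bound on the staircase**: every run of the
typed procedure (any `N`, any `Rd`) leaves `Regime.cuspCurve` within `Σ(E₀) / b` steps, `Σ(E₀)` the total cusp index of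
the initial state (`Multiset.sum (cuspMultiset E₀)`) and `b` its exponent — for K4.6's `K_{p,n}` this is `⌊n/p⌋`
(ATLAS-RUN j259568: resolution length `⌊n/p⌋`). While the stages `0, …, k` lie in the regime, `Σ(E_k) + k·b ≤ Σ(E₀)`
(`Step.sum_cuspMultiset_add_le`) and `Σ(E_k) > b` (every stage of a run is singular, `Run.sing_nonempty`, and indices at
singular points exceed `b`). [folklore] -/
theorem Run.exists_exit_le_sum_div_of_cuspCurve {Rd : Reading p K N} (r : Run N Rd) :
    ∃ k ≤ (cuspMultiset (r.E 0)).sum / (r.E 0).b, ¬ Regime.cuspCurve (p := p) (K := K) (r.A k) (r.E k) := by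
  classical
  by_contra h
  simp only [not_exists, not_and, not_not] at h
  set Φ : ℕ → ℕ := fun k => (cuspMultiset (r.E k)).sum with hΦ
  set b := (r.E 0).b with hb
  set k₀ := Φ 0 / b with hk₀
  have hmono : ∀ k, k ≤ k₀ → Φ k + k * b ≤ Φ 0 := by
    intro k
    induction k with
    | zero => intro _; simp
    | succ k ih =>
      intro hk
      have hstep : Φ (k + 1) + (r.E k).b ≤ Φ k := by
        have := (r.step k).sum_cuspMultiset_add_le (h k (by omega))
        simp only [hΦ]
        rw [r.E_succ k]
        exact this
      rw [r.b_eq k] at hstep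
      have := ih (by omega)
      rw [Nat.succ_mul]
      omega
  -- at stage `k₀` (in the regime) the total index exceeds `b`
  have hRg := h k₀ le_rfl
  obtain ⟨hbpos, hfin, -, hcusp⟩ := hRg
  obtain ⟨ξ, hξ⟩ := r.sing_nonempty k₀
  obtain ⟨hnd, hshape⟩ := Cusp.cuspIndex_spec (hcusp ξ hξ)
  have hbd : (r.E k₀).b < cuspIndexAt (r.E k₀) ξ :=
    Cusp.lt_of_cuspShape_of_le_pow hshape hnd (stalkIdeal_le_pow_of_mem_sing hξ)
  have hle : cuspIndexAt (r.E k₀) ξ ≤ Φ k₀ := by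
    simp only [hΦ]
    rw [cuspMultiset_eq _ hfin, ← Finset.sum_eq_multiset_sum]
    exact Finset.single_le_sum (fun _ _ => Nat.zero_le _) (hfin.mem_toFinset.mpr hξ)
  rw [r.b_eq k₀] at hbd hbpos
  have h1 := hmono k₀ le_rfl
  have h2 : (k₀ + 1) * b ≤ Φ 0 := by rw [Nat.succ_mul]; omega
  have h3 : k₀ + 1 ≤ Φ 0 / b := (Nat.le_div_iff_mul_le hbpos).mpr h2
  omega

end Campaign

end CampaignW46

end Summit.ResolutionOfSingularities.ResolutionOfSingularities.Theorems

end
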